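import Summits.ResolutionOfSingularities.ResolutionOfSingularities.Theorems.EquisingularLiftEquisingularLiftNatDirectionChartIdeal
import HarnessLib

/-!
# [OURS · L1 W4.5(b) · EL♮(3)] T-DIRLIFT-UP (L), brick C2, bridge piece X2 — ring relations between two adapted frames on a common affine

Crux chain w45b (cell `res-hironaka`, slot W4.5(b)), child crux **EL♮(3)** = stmt-ResolutionOfSingularities-20148, route EquisingularLift; object (L),
brick C2 (res-type-027 g15's census / cut), bridge piece **X2** of the (★) assembly `cechPic_pullback_detClass_conormal_section` (signature
`L/res-type-027/Bridge-pieces.sig.lean` d74e4ef5f55702f7, VERBATIM). Written by res-L1-w45b-stub-4 g9. HONEST FRAMING: OURS; NOT a statement of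
any manuscript; AI-written, weaker than expert review. No `sorry`; standard axioms; DEF-FREE. `--supports stmt-ResolutionOfSingularities-20148 --as helper`.

WHAT (`exists_adaptedFrame_rel`). Two adapted frames `cx` on `Wx` and `cy` on `Wy` of the trace ideal `Ī` (each generating `Ī` on its chart,
with `𝒟' = (c₀) + Ī²` there) satisfy on any affine `W″` below both: `cy₀| = a₀ cx₀| + b₀ cx₁|` with `b₀ ∈ Ī(W″)`, and `cy₁| = m cx₀| + v cx₁|`
— B1c's hypotheses `hrel₀` / `hrel₁`. PROOF: restrict (`map_secRes_ideal`): `Ī(W″) = (cx₀|, cx₁|) = (cy₀|, cy₁|)` and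
`𝒟'(W″) = (cx₀|) + Ī(W″)² = (cy₀|) + Ī(W″)²`; `cy₁| ∈ Ī(W″)` is `Ideal.mem_span_pair`; `cy₀| ∈ (cx₀|) + Ī(W″)²` and
`Ī(W″)² = Ī·(cx₀|) + Ī·(cx₁|)` (`Ideal.mul_sup`, `Ideal.mem_mul_span_singleton`) give `cy₀| = (t + p) cx₀| + q cx₁|` with `p, q ∈ Ī(W″)`.

References (method): H. Matsumura, *Commutative Ring Theory* (1986), §16 (quasi-regular sequences; index only).
-/

set_option linter.dupNamespace false -- mandated namespace `Summit.<Summit>.<Problem>` of this single-conjunct summit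

noncomputable section

open CategoryTheory AlgebraicGeometry Opposite TopologicalSpace IsLocalRing
open Literature.AlgebraicGeometry.Resolution Literature.AlgebraicGeometry.Modules
open AlgebraicGeometry.Scheme.IdealSheafData

namespace Summit.ResolutionOfSingularities.ResolutionOfSingularities.Cruxes.EquisingularLiftNat.Sections

/-- Membership in `I * span {a, b}`: `z = p a + q b` with `p, q ∈ I`. [folklore] -/
theorem exists_of_mem_mul_span_pair {R : Type*} [CommRing R] (I : Ideal R) (a b z : R) (hz : z ∈ I * Ideal.span {a, b}) :
    ∃ p q : R, p ∈ I ∧ q ∈ I ∧ z = p * a + q * b := by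
  have hsplit : Ideal.span ({a, b} : Set R) = Ideal.span {a} ⊔ Ideal.span {b} := by
    rw [← Ideal.span_union, Set.singleton_union]
  rw [hsplit, Ideal.mul_sup] at hz
  obtain ⟨za, hza, zb, hzb, rfl⟩ := Submodule.mem_sup.mp hz
  obtain ⟨p, hp, rfl⟩ := Ideal.mem_mul_span_singleton.mp hza
  obtain ⟨q, hq, rfl⟩ := Ideal.mem_mul_span_singleton.mp hzb
  exact ⟨p, q, hp, hq, rfl⟩

/-- **X2 — ring relations between two adapted frames on a common affine.** See the module docstring.
[cite: Matsumura1987, §16 (index only)] [OURS · L1 W4.5b · C2 bridge piece X2; signature res-type-027 VERBATIM] toward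
`stub_elnat_three_liftSections` (stmt-ResolutionOfSingularities-20148); NOT a statement of the manuscript. -/
theorem exists_adaptedFrame_rel {G₀ : Scheme.{0}} (Ī 𝒟' : G₀.IdealSheafData) (Wx Wy W'' : G₀.affineOpens)
    (cx : Fin 2 → Γ(G₀, (Wx : G₀.Opens))) (cy : Fin 2 → Γ(G₀, (Wy : G₀.Opens)))
    (hcx : Ideal.span (Set.range cx) = Ī.ideal Wx) (hcy : Ideal.span (Set.range cy) = Ī.ideal Wy)
    (h𝒟x : 𝒟'.ideal Wx = Ideal.span {cx 0} ⊔ (Ī.ideal Wx) ^ 2) (h𝒟y : 𝒟'.ideal Wy = Ideal.span {cy 0} ⊔ (Ī.ideal Wy) ^ 2)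
    (hx'' : (W'' : G₀.Opens) ≤ Wx) (hy'' : (W'' : G₀.Opens) ≤ Wy) :
    ∃ a₀ b₀ m v : Γ(G₀, (W'' : G₀.Opens)), b₀ ∈ Ī.ideal W'' ∧
      G₀.presheaf.map (homOfLE hy'').op (cy 0) =
          a₀ * G₀.presheaf.map (homOfLE hx'').op (cx 0) + b₀ * G₀.presheaf.map (homOfLE hx'').op (cx 1) ∧
        G₀.presheaf.map (homOfLE hy'').op (cy 1) =
          m * G₀.presheaf.map (homOfLE hx'').op (cx 0) + v * G₀.presheaf.map (homOfLE hx'').op (cx 1) := by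
  -- notation: the restricted frames
  let rx : Γ(G₀, (Wx : G₀.Opens)) →+* Γ(G₀, (W'' : G₀.Opens)) := secRes G₀ hx''
  let ry : Γ(G₀, (Wy : G₀.Opens)) →+* Γ(G₀, (W'' : G₀.Opens)) := secRes G₀ hy''
  have hrange : ∀ {V : G₀.affineOpens} (c : Fin 2 → Γ(G₀, (V : G₀.Opens))), Set.range c = {c 0, c 1} := by
    intro V c
    ext t
    simp only [Set.mem_range, Set.mem_insert_iff, Set.mem_singleton_iff]
    constructor
    · rintro ⟨i, rfl⟩
      rcases Fin.exists_fin_two.mp ⟨i, rfl⟩ with rfl | rfl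
      · exact Or.inl rfl
      · exact Or.inr rfl
    · rintro (rfl | rfl)
      · exact ⟨0, rfl⟩
      · exact ⟨1, rfl⟩
  -- `Ī(W'')` in the two frames
  have hIx : Ī.ideal W'' = Ideal.span {rx (cx 0), rx (cx 1)} := by
    rw [← map_secRes_ideal Ī hx'', ← hcx, Ideal.map_span, hrange, Set.image_pair]
  have hIy : Ī.ideal W'' = Ideal.span {ry (cy 0), ry (cy 1)} := by
    rw [← map_secRes_ideal Ī hy'', ← hcy, Ideal.map_span, hrange, Set.image_pair]
  -- `𝒟'(W'')` in the two frames
  have hDx : 𝒟'.ideal W'' = Ideal.span {rx (cx 0)} ⊔ (Ī.ideal W'') ^ 2 := by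
    rw [← map_secRes_ideal 𝒟' hx'', h𝒟x, Ideal.map_sup, Ideal.map_pow, Ideal.map_span, Set.image_singleton, map_secRes_ideal Ī hx'']
  have hDy : 𝒟'.ideal W'' = Ideal.span {ry (cy 0)} ⊔ (Ī.ideal W'') ^ 2 := by
    rw [← map_secRes_ideal 𝒟' hy'', h𝒟y, Ideal.map_sup, Ideal.map_pow, Ideal.map_span, Set.image_singleton, map_secRes_ideal Ī hy'']
  -- `cy 1| ∈ Ī(W'') = (cx 0|, cx 1|)`
  have hcy1 : ry (cy 1) ∈ Ideal.span {rx (cx 0), rx (cx 1)} := by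
    rw [← hIx, hIy]; exact Ideal.subset_span (Or.inr rfl)
  obtain ⟨m, v, hmv⟩ := Ideal.mem_span_pair.mp hcy1
  -- `cy 0| ∈ 𝒟'(W'') = (cx 0|) + Ī(W'')²`, and `Ī(W'')² = Ī·(cx 0|) + Ī·(cx 1|)`
  have hcy0 : ry (cy 0) ∈ Ideal.span {rx (cx 0)} ⊔ (Ī.ideal W'') ^ 2 := by
    rw [← hDx, hDy]; exact Ideal.mem_sup_left (Ideal.subset_span rfl)
  obtain ⟨za, hza, zb, hzb, hsum⟩ := Submodule.mem_sup.mp hcy0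
  obtain ⟨t, rfl⟩ := Ideal.mem_span_singleton'.mp hza
  have hzb' : zb ∈ Ī.ideal W'' * Ideal.span {rx (cx 0), rx (cx 1)} := by
    rw [← hIx, ← pow_two]; exact hzb
  obtain ⟨p, q, hp, hq, rfl⟩ := exists_of_mem_mul_span_pair _ _ _ _ hzb'
  refine ⟨t + p, q, m, v, hq, ?_, ?_⟩
  · change ry (cy 0) = (t + p) * rx (cx 0) + q * rx (cx 1)
    rw [← hsum]; ring
  · change ry (cy 1) = m * rx (cx 0) + v * rx (cx 1)
    rw [← hmv]

end Summit.ResolutionOfSingularities.ResolutionOfSingularities.Cruxes.EquisingularLiftNat.Sections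

end
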